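import Literature.Computability.QuantumComplexity.DFKOInfluenceBoundProofs
import Literature.Computability.QuantumComplexity.PseudoBounded

/-!
# Route `SosSandwich`, crux `PseudoBoundedAA` (stmt-QuantumAdvantage-15237): the crux holds at every FIXED order —
# PB-AA with the Dinur–Friedgut–Kindler–O'Donnell loss `ε³ / 2^{42 T}`, unconditionally

PB-AA asks for `maxᵢ Infᵢ[p] ≥ C (ε/T)^c` for every `p ∈ K_T` (pseudo-bounded of order `T`: `p` and `1 − p` are
sums of squares of polynomials of total degree `≤ T` on the cube) with `Var[p] ≥ ε > 0`. A member of `K_T` takes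
values in `[0,1]` on the cube and agrees there with its representative `Σⱼ qⱼ²` of total degree `≤ 2T` (same
variance, same influences), so the tree's discharged DFKO bound (`DFKOInfluenceBoundProofs`:
`maxInf ≥ Var³/2^{21 d}` for `[0,1]`-bounded polynomials of degree `≤ d`) gives, with `d = 2T`,

  `p ∈ K_T`, `0 < ε ≤ Var[p]`  ⟹  `∃ i, Infᵢ[p] ≥ ε³ / 2^{42 T}`   (`pseudoBoundedAA_dfko`),

in the literal inline vocabulary of the route file (`ev`, `avg`, `xⁱ = Function.update x i (!x i)`). Consequences
recorded for the crux's bookkeeping: PB-AA restricted to any bounded range of orders `T ≤ T₀` HOLDS with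
`(c, C) = (3, 2^{-42 T₀})` (`pseudoBoundedAA_of_order_le`), so every refuting family of the crux must have
unbounded order `T → ∞` with `maxInf` decaying faster than every `(ε/T)^c` — the route's KILL CRITERION "one
pseudo-bounded family of order 2 with `Var ≥ const` and `maxInf → 0`" is thereby CLOSED (no such family exists:
`pseudoBounded_two_maxInf_ge`). What the crux asks beyond this file is exactly the improvement of the `T`-dependence
from `2^{-42T}` to `T^{-c}`.

No named facts: `dfko2007_influence_bounded` is discharged in the tree (`dfko2007_influence_bounded_holds`); this
file re-runs its last step with the explicit constants `(3, 21)` at `d = 2T`.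
[cite: DinurEtAl2007, Thm. 1.6] [cite: AaronsonAmbainis2014, Conj. 6 and Thm. 3.3] [cite: KaniewskiLeeDewolf2015, Def. 7]
-/

set_option linter.dupNamespace false -- D-0017: single-problem summit ⇒ `QuantumAdvantage.QuantumAdvantage` by design

noncomputable section
namespace Summit.QuantumAdvantage.QuantumAdvantage.Theorems.SosSandwich

open Finset MvPolynomial Literature.Computability.QuantumComplexity
open Literature.Computability.Complexity.LowDegree (cubeFourierCoeff)

variable {N : ℕ}

/-- **DFKO for `[0,1]`-bounded polynomials, explicit constants** (the last step of the tree's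
`dfko2007_influence_bounded_holds`, exposed with `(a, C) = (3, 21)`): a real polynomial of total degree `≤ d`,
`d ≥ 1`, with `0 ≤ p ≤ 1` on the cube and `0 < ε ≤ Var[p]` has a variable with `Infᵢ[p] ≥ ε³/2^{21 d}`.
[cite: DinurEtAl2007, Thm. 1.6] -/
theorem exists_influence_ge_dfko {d : ℕ} (hd : 1 ≤ d) {p : MvPolynomial (Fin N) ℝ} (hp : p.totalDegree ≤ d)
    (hb : ∀ x, 0 ≤ evalBool p x ∧ evalBool p x ≤ 1) {ε : ℝ} (hε : 0 < ε) (hv : ε ≤ boolVariance p) :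
    ∃ i : Fin N, ε ^ 3 / (2 : ℝ) ^ (21 * d) ≤ influence i p := by
  by_contra hcon
  push Not at hcon
  set g := evalBool p with hg
  have h0 : ∀ x, 0 ≤ g x := fun x => (hb x).1
  have h1 : ∀ x, g x ≤ 1 := fun x => (hb x).2
  have hdeg : ∀ S : Finset (Fin N), d < S.card → cubeFourierCoeff g S = 0 :=
    fun S hS => cubeFourierCoeff_evalBool_eq_zero hp hS
  set t : ℝ := ε ^ 3 / (2 : ℝ) ^ (21 * d) / 4 with ht_def
  have ht : 0 ≤ t := by positivity
  have hI : ∀ i, ∑ S ∈ Finset.univ.filter (fun S : Finset (Fin N) => i ∈ S), cubeFourierCoeff g S ^ 2 ≤ t := by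
    intro i
    have h := hcon i
    rw [influence_eq_sum_sq_fourier] at h
    rw [ht_def]
    linarith
  have main := DFKO.tailWeight_one_pow_three_le h0 h1 hd hdeg ht hI
  rw [← boolVariance_eq_tailWeight_one] at main
  have hε3 : ε ^ 3 ≤ boolVariance p ^ 3 := pow_le_pow_left₀ hε.le hv 3
  have h4 : (2 : ℝ) ^ (21 * d) * t = ε ^ 3 / 4 := by rw [ht_def]; field_simp
  rw [h4] at main
  nlinarith [pow_pos hε 3]

/-- **A member of `K_T` has a `[0,1]`-bounded representative of total degree `≤ 2T` with the same cube values**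
(`Σⱼ qⱼ²` from an SOS certificate of `p`). [cite: KaniewskiLeeDewolf2015, Def. 7] [cite: AaronsonAmbainis2014, Thm. 3.3] -/
theorem exists_representative_of_pseudoBounded {T : ℕ} {p : MvPolynomial (Fin N) ℝ} (h : PseudoBounded T p) :
    ∃ p' : MvPolynomial (Fin N) ℝ, p'.totalDegree ≤ 2 * T ∧ (∀ x, 0 ≤ evalBool p' x ∧ evalBool p' x ≤ 1) ∧
      evalBool p' = evalBool p := by
  obtain ⟨m, q, r, hdeg, hval⟩ := h
  refine ⟨∑ j, q j ^ 2, ?_, ?_, ?_⟩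
  · refine (totalDegree_finsetSum _ _).trans (Finset.sup_le fun j _ => ?_)
    exact (totalDegree_pow _ _).trans (Nat.mul_le_mul_left 2 (hdeg j).1)
  · intro x
    have hev : evalBool (∑ j, q j ^ 2) x = evalBool p x := by
      unfold evalBool; rw [map_sum]; simp only [map_pow]; exact ((hval x).1).symm
    have h1 : evalBool p x = ∑ j, evalBool (q j) x ^ 2 := (hval x).1
    have h2 : 1 - evalBool p x = ∑ j, evalBool (r j) x ^ 2 := (hval x).2
    rw [hev]
    refine ⟨?_, ?_⟩
    · rw [h1]; exact Finset.sum_nonneg fun j _ => sq_nonneg _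
    · have : 0 ≤ 1 - evalBool p x := by rw [h2]; exact Finset.sum_nonneg fun j _ => sq_nonneg _
      linarith
  · funext x
    unfold evalBool; rw [map_sum]; simp only [map_pow]; exact ((hval x).1).symm

/-- **PB-AA with the DFKO loss, unconditionally** (literal inline vocabulary of the route file): every pseudo-bounded
`p` of order `T ≥ 1` with `Var[p] ≥ ε > 0` has a variable with `Infᵢ[p] ≥ ε³ / 2^{42 T}`. The crux
`PseudoBoundedAA` (stmt-QuantumAdvantage-15237) asks to improve `2^{-42T}` to `T^{-c}`.
[cite: DinurEtAl2007, Thm. 1.6] [cite: AaronsonAmbainis2014, Conj. 6] -/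
theorem pseudoBoundedAA_dfko (N T : ℕ) (p : MvPolynomial (Fin N) ℝ) (ε : ℝ) :
    let ev : MvPolynomial (Fin N) ℝ → (Fin N → Bool) → ℝ :=
      fun f x => MvPolynomial.eval (fun k => if x k then (1 : ℝ) else 0) f
    let avg : ((Fin N → Bool) → ℝ) → ℝ := fun g => (∑ x : Fin N → Bool, g x) / (2 : ℝ) ^ N
    1 ≤ T →
    (∃ (m : ℕ) (q r : Fin m → MvPolynomial (Fin N) ℝ),
        (∀ j, (q j).totalDegree ≤ T ∧ (r j).totalDegree ≤ T) ∧
          ∀ x : Fin N → Bool, ev p x = ∑ j, ev (q j) x ^ 2 ∧ 1 - ev p x = ∑ j, ev (r j) x ^ 2) →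
    0 < ε → ε ≤ (avg fun x => (ev p x - avg (ev p)) ^ 2) →
    ∃ i : Fin N, ε ^ 3 / (2 : ℝ) ^ (42 * T) ≤ (avg fun x => (ev p x - ev p (Function.update x i (!x i))) ^ 2) := by
  intro ev avg hT hPB hε hv
  change PseudoBounded T p at hPB
  change ε ≤ boolVariance p at hv
  change ∃ i : Fin N, ε ^ 3 / (2 : ℝ) ^ (42 * T) ≤ influence i p
  obtain ⟨p', hdeg, hb, hfun⟩ := exists_representative_of_pseudoBounded hPB
  have hvar : boolVariance p' = boolVariance p := by unfold boolVariance; rw [hfun]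
  have hinf : ∀ i, influence i p' = influence i p := fun i => by unfold influence; rw [hfun]
  have hd : 1 ≤ 2 * T := by omega
  obtain ⟨i, hi⟩ := exists_influence_ge_dfko hd hdeg hb hε (hvar ▸ hv)
  refine ⟨i, ?_⟩
  rw [← hinf i, show 42 * T = 21 * (2 * T) by ring]
  exact hi

/-- **The crux holds on every bounded range of orders.** For each `T₀`, the body of `PseudoBoundedAA` restricted to
orders `T ≤ T₀` holds with `(c, C) = (3, 2^{-42 T₀})` — so a refuting family of the crux must have unbounded order.
[cite: DinurEtAl2007, Thm. 1.6] [cite: AaronsonAmbainis2014, Conj. 6] -/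
theorem pseudoBoundedAA_of_order_le (T₀ : ℕ) :
    ∃ (c : ℕ) (C : ℝ), 0 < C ∧ ∀ (N T : ℕ) (p : MvPolynomial (Fin N) ℝ) (ε : ℝ),
      let ev : MvPolynomial (Fin N) ℝ → (Fin N → Bool) → ℝ :=
        fun f x => MvPolynomial.eval (fun k => if x k then (1 : ℝ) else 0) f
      let avg : ((Fin N → Bool) → ℝ) → ℝ := fun g => (∑ x : Fin N → Bool, g x) / (2 : ℝ) ^ N
      T ≤ T₀ → 1 ≤ T →
      (∃ (m : ℕ) (q r : Fin m → MvPolynomial (Fin N) ℝ),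
          (∀ j, (q j).totalDegree ≤ T ∧ (r j).totalDegree ≤ T) ∧
            ∀ x : Fin N → Bool, ev p x = ∑ j, ev (q j) x ^ 2 ∧ 1 - ev p x = ∑ j, ev (r j) x ^ 2) →
      0 < ε → ε ≤ (avg fun x => (ev p x - avg (ev p)) ^ 2) →
      ∃ i : Fin N, C * (ε / T) ^ c ≤ (avg fun x => (ev p x - ev p (Function.update x i (!x i))) ^ 2) := by
  refine ⟨3, 1 / (2 : ℝ) ^ (42 * T₀), by positivity, ?_⟩
  intro N T p ε ev avg hT0 hT hPB hε hv
  obtain ⟨i, hi⟩ := pseudoBoundedAA_dfko N T p ε hT hPB hε hv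
  refine ⟨i, le_trans ?_ hi⟩
  have hT1 : (1 : ℝ) ≤ T := by exact_mod_cast hT
  have hεT : ε / T ≤ ε := div_le_self hε.le hT1
  have hεT0 : 0 ≤ ε / T := div_nonneg hε.le (by positivity)
  have hpow : (ε / T) ^ 3 ≤ ε ^ 3 := pow_le_pow_left₀ hεT0 hεT 3
  have h2 : (2 : ℝ) ^ (42 * T) ≤ (2 : ℝ) ^ (42 * T₀) :=
    pow_le_pow_right₀ (by norm_num) (Nat.mul_le_mul_left 42 hT0)
  have h2pos : (0 : ℝ) < (2 : ℝ) ^ (42 * T) := by positivity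
  calc 1 / (2 : ℝ) ^ (42 * T₀) * (ε / T) ^ 3 ≤ 1 / (2 : ℝ) ^ (42 * T) * ε ^ 3 :=
        mul_le_mul (one_div_le_one_div_of_le h2pos h2) hpow (pow_nonneg hεT0 3) (by positivity)
    _ = ε ^ 3 / (2 : ℝ) ^ (42 * T) := by ring

/-- **The order-2 kill criterion is closed.** The route's "cheapest falsifier" — one pseudo-bounded family of order
`2` with `Var ≥ const` and `maxInf → 0` — does not exist: at order `2`, `Var[p] ≥ ε > 0` forces
`maxInf ≥ ε³/2^{84}` uniformly in `N`. [cite: DinurEtAl2007, Thm. 1.6] -/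
theorem pseudoBounded_two_maxInf_ge {p : MvPolynomial (Fin N) ℝ} (h : PseudoBounded 2 p) {ε : ℝ} (hε : 0 < ε)
    (hv : ε ≤ boolVariance p) : ∃ i : Fin N, ε ^ 3 / (2 : ℝ) ^ 84 ≤ influence i p := by
  obtain ⟨i, hi⟩ := pseudoBoundedAA_dfko N 2 p ε (by norm_num) h hε hv
  change ε ^ 3 / (2 : ℝ) ^ (42 * 2) ≤ influence i p at hi
  have h84 : (2 : ℝ) ^ (42 * 2) = (2 : ℝ) ^ 84 := by norm_num
  rw [h84] at hi
  exact ⟨i, hi⟩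

end Summit.QuantumAdvantage.QuantumAdvantage.Theorems.SosSandwich
end
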